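import Literature.NumberTheory.LFunctions.SiegelZeroFormSumAsymptotic
import Literature.NumberTheory.LFunctions.RealCharacterDivisorSumRootCount
import Literature.NumberTheory.LFunctions.GoldfeldSchinzelHarmonicTail
import Literature.NumberTheory.DiophantineGeometry.AbcWave0GranvilleStarkTheorem2Proofs
import Literature.NumberTheory.QuadraticFields.KroneckerCharacterExists
import HarnessLib

/-!
# Goldfeld–Schinzel 1975, Lemma 1 — PROVED (`goldfeldSchinzel1975_lemma1_holds`)

Topic `Literature/NumberTheory/LFunctions` (namespace `Literature.NumberTheory.LFunctions`, helpers in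
`GoldfeldSchinzel1975`). Everything in this file is PROVED (theorems only; no definitions, no named
facts). It discharges the named fact `goldfeldSchinzel1975_lemma1` of
`SiegelZeroFormSumAsymptotic.lean` exactly as typed:

D. M. Goldfeld, A. Schinzel, *On Siegel's zero*, Ann. Scuola Norm. Sup. Pisa (4) **2** (1975), p. 572:
"**LEMMA 1.** Let `f(d) = (log|d|/log log|d|)²`. Then
`Σ_{N𝔞 ≤ ¼√|d| f(d)} 1/N𝔞 = (π²/6) Σ' (1/a)(1 + O((log log|d|)²/log|d|))`, where the left hand sum
goes over all ideals `𝔞 ∈ Q(√d)` with norm `≤ ¼√|d| f(d)` and the constant in the `O`-symbol is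
effectively computable."

## The printed proof (pp. 572–575) and the road taken

(3) p. 573: every ideal is `u[a, (b + √d)/2]` with `−a < b ≤ a`, `b² ≡ d (mod 4a)`, `N𝔞 = u²a`, so
`Σ_{N𝔞 ≤ x} 1/N𝔞 = Σ' (1/a) Σ_{u² ≤ x/a} 1/u² + O(S)`, `S = Σ_{¼√|d| ≤ a ≤ x} ρ(a)/a`; the inner sums are
`π²/6 + O(f^{−1/2})`; (4)–(5) pp. 573–575: `S ≪ ((log log|d|)²/log|d|) Σ'` by splitting `a` into
numbers with a prime-power factor `> l(d) = d^{1/(21 log log|d|)}` (Mertens) and the others.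
In the tree: the ideal count is the coefficient of `ζ_K = ζ·L(κ)` (`exists_kroneckerChar`,
`dedekindZeta_eq_riemannZeta_mul_LSeries_of_kronecker`, coefficient uniqueness —
`DiophantineGeometry.charDivisorSum_eq_card`), `r = 1_□ ∗ ρ_{d}` and (3) exactly
(`DiscRootCount.charDivisorSum_eq_sqInd_mul_rho`, `sum_charDivisorSum_div_le/_ge`), the window count
`pairCount d a = ρ_d(a)` (`GoldfeldSchinzel1975.pairCount_eq_card_sqrtsMod`), and the tail (4)–(5)
in the generic form `GSTail.tail_le` (rough part as printed; smooth part by Rankin's trick instead of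
the printed `ω(a) ≥ k₀` count — see that file). The threshold `D₀` and the constant `C` are
existential (the source: "effectively computable"); we take `log l = log|d|/(21 log log|d|)` as
printed and an explicit (huge) `D₀`.

## References

* D. M. Goldfeld, A. Schinzel, On Siegel's zero, Ann. Scuola Norm. Sup. Pisa (4) 2 (1975), Lemma 1
  p. 572 and its proof, §2 pp. 572–575. [GoldfeldSchinzel1975]
-/

noncomputable section

open Finset Real ArithmeticFunction
open scoped Classical

namespace Literature.NumberTheory.LFunctions

namespace GoldfeldSchinzel1975

open Literature.NumberTheory.LFunctions.DiscRootCount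
open Literature.NumberTheory.LFunctions.RealChar (charDivisorSum)
open Literature.NumberTheory.QuadraticFields.BinaryQuadraticForm (kroneckerOnePrimes
  mem_kroneckerOnePrimes prime_of_mem_kroneckerOnePrimes not_dvd_of_mem_kroneckerOnePrimes
  two_mem_kroneckerOnePrimes_iff jacobiSym_eq_zero_of_prime_dvd
  jacobiSym_eq_one_of_mem_kroneckerOnePrimes jacobiSym_eq_neg_one_of_not_mem_kroneckerOnePrimes)

/-! ### The window `−a < b ≤ a` versus `0 ≤ b < 2a`: `pairCount d a = ρ_d(a)` -/

/-- **`pairCount d a = #sqrtsMod d a`**: the forms `(a, b, ·)` with `−a < b ≤ a`, `4a ∣ b² − d` are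
counted by the residues `b (mod 2a)` with `b² ≡ d (mod 4a)` ("the representation becomes unique").
[cite: GoldfeldSchinzel1975, §2 proof of Lemma 1 p. 573] -/
theorem pairCount_eq_card_sqrtsMod (d : ℤ) (a : ℕ) : pairCount d a = (sqrtsMod d a).card := by
  unfold pairCount sqrtsMod
  refine card_bij' (fun b _ => (if b < 0 then b + 2 * a else b).toNat)
    (fun c _ => if (c : ℤ) ≤ a then (c : ℤ) else (c : ℤ) - 2 * a) ?_ ?_ ?_ ?_
  · intro b hb
    rw [mem_filter, mem_Ioc] at hb
    obtain ⟨⟨hb1, hb2⟩, hdvd⟩ := hb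
    rw [mem_filter, mem_range]
    by_cases hneg : b < 0
    · rw [if_pos hneg]
      have h0 : 0 ≤ b + 2 * a := by omega
      refine ⟨by omega, ?_⟩
      rw [Int.toNat_of_nonneg h0]
      have : (b + 2 * a) ^ 2 - d = (b ^ 2 - d) + 4 * (a : ℤ) * (b + a) := by ring
      rw [this]
      exact dvd_add hdvd (Dvd.intro _ rfl)
    · rw [if_neg hneg]
      have h0 : 0 ≤ b := by omega
      refine ⟨by omega, ?_⟩
      rw [Int.toNat_of_nonneg h0]
      exact hdvd
  · intro c hc
    rw [mem_filter, mem_range] at hc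
    obtain ⟨hc2, hdvd⟩ := hc
    rw [mem_filter, mem_Ioc]
    by_cases hle : (c : ℤ) ≤ a
    · rw [if_pos hle]
      exact ⟨⟨by omega, hle⟩, hdvd⟩
    · rw [if_neg hle]
      refine ⟨⟨by omega, by omega⟩, ?_⟩
      have : ((c : ℤ) - 2 * a) ^ 2 - d = ((c : ℤ) ^ 2 - d) + 4 * (a : ℤ) * (a - c) := by ring
      rw [this]
      exact dvd_add hdvd (Dvd.intro _ rfl)
  · intro b hb
    rw [mem_filter, mem_Ioc] at hb
    obtain ⟨⟨hb1, hb2⟩, -⟩ := hb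
    by_cases hneg : b < 0
    · rw [if_pos hneg, Int.toNat_of_nonneg (by omega)]
      rw [if_neg (by omega)]
      ring
    · rw [if_neg hneg, Int.toNat_of_nonneg (by omega), if_pos hb2]
  · intro c hc
    rw [mem_filter, mem_range] at hc
    obtain ⟨hc2, -⟩ := hc
    by_cases hle : (c : ℤ) ≤ a
    · rw [if_pos hle, if_neg (by omega)]
      simp
    · rw [if_neg hle, if_pos (by omega)]
      have : (c : ℤ) - 2 * a + 2 * a = c := by ring
      rw [this]
      simp

/-- The window condition `16a² < |d|` on integers `a ≥ 1` is `a ≤ M` with `M = ⌊√((|d| − 1)/16)⌋`.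
[cite: GoldfeldSchinzel1975, Theorem 1 (2) p. 571] -/
theorem filter_window_eq (Δ : ℕ) :
    (Icc 1 Δ).filter (fun a : ℕ => 16 * a ^ 2 < Δ) = Icc 1 (Nat.sqrt ((Δ - 1) / 16)) := by
  ext a
  simp only [mem_filter, mem_Icc]
  constructor
  · rintro ⟨⟨ha1, -⟩, hlt⟩
    refine ⟨ha1, Nat.le_sqrt.mpr ?_⟩
    rw [Nat.le_div_iff_mul_le (by norm_num)]
    have : a * a * 16 = 16 * a ^ 2 := by ring
    omega
  · rintro ⟨ha1, hle⟩
    have h := Nat.le_sqrt.mp hle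
    rw [Nat.le_div_iff_mul_le (by norm_num)] at h
    have h16 : 16 * a ^ 2 = a * a * 16 := by ring
    have hΔ : 1 ≤ Δ := by
      by_contra h0
      push Not at h0
      have : Δ = 0 := by omega
      subst this
      simp at h
      omega
    have h1 : a ≤ a * a := Nat.le_mul_self a
    have h2 : a * a ≤ a * a * 16 := Nat.le_mul_of_pos_right _ (by norm_num)
    refine ⟨⟨ha1, by omega⟩, by omega⟩

/-- **`Σ' 1/a = Σ_{a ≤ M} ρ_d(a)/a`**, `M = ⌊√((|d| − 1)/16)⌋` (the window sum of Theorem 1 in the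
`ρ_d` currency of `RealCharacterDivisorSumRootCount.lean`). [cite: GoldfeldSchinzel1975, Theorem 1 (2) p. 571] -/
theorem formSum_eq_sum_rho (d : ℤ) :
    formSum d = ∑ a ∈ Ioc 0 (Nat.sqrt ((d.natAbs - 1) / 16)), rho d a / (a : ℝ) := by
  rw [formSum, filter_window_eq, show Ioc 0 (Nat.sqrt ((d.natAbs - 1) / 16)) =
    Icc 1 (Nat.sqrt ((d.natAbs - 1) / 16)) from rfl]
  refine sum_congr rfl fun a _ => ?_
  rw [rho_apply, pairCount_eq_card_sqrtsMod]

/-- `Σ' 1/a ≥ 1` for `|d| ≥ 17`, `d ≡ 0, 1 (mod 4)` (the term `a = 1`: `ρ_d(1) = 1`).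
[cite: GoldfeldSchinzel1975, Theorem 1 (2) p. 571] -/
theorem one_le_sum_rho {d : ℤ} (h4 : d % 4 = 0 ∨ d % 4 = 1) (hd : 17 ≤ d.natAbs) :
    1 ≤ ∑ a ∈ Ioc 0 (Nat.sqrt ((d.natAbs - 1) / 16)), rho d a / (a : ℝ) := by
  have hM : 1 ≤ Nat.sqrt ((d.natAbs - 1) / 16) := by
    rw [Nat.le_sqrt, Nat.le_div_iff_mul_le (by norm_num)]; omega
  have h1 : (1 : ℕ) ∈ Ioc 0 (Nat.sqrt ((d.natAbs - 1) / 16)) := by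
    rw [mem_Ioc]; exact ⟨zero_lt_one, hM⟩
  calc (1 : ℝ) = rho d 1 / ((1 : ℕ) : ℝ) := by rw [rho_apply, card_sqrtsMod_one h4]; norm_num
    _ ≤ _ := single_le_sum (f := fun a => rho d a / (a : ℝ))
        (fun a _ => div_nonneg (rho_nonneg d a) (Nat.cast_nonneg _)) h1

/-! ### `ρ_d(p^{k+1}) ≤ 2ρ_d(p^k)` (the hypothesis of `GSTail.tail_le`) -/

/-- `ρ_d(p^{k+1}) ≤ 2 ρ_d(p^k)` for a fundamental `d` (local values: `(1, 0, 0, …)` ramified,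
`(2, 2, …)` split, `(0, 0, …)` inert, after `ρ_d(1) = 1`). [cite: GoldfeldSchinzel1975, §2 proof of Lemma 1 (4) p. 573] -/
theorem rho_prime_pow_succ_le {d : ℤ}
    (hfd : (d % 4 = 1 ∧ Squarefree d ∧ d ≠ 1) ∨
      (4 ∣ d ∧ (d / 4 % 4 = 2 ∨ d / 4 % 4 = 3) ∧ Squarefree (d / 4)))
    (p k : ℕ) (hp : p.Prime) : rho d (p ^ (k + 1)) ≤ 2 * rho d (p ^ k) := by
  have h4 := emod_four_of_isFundamental hfd
  rw [rho_apply, rho_apply]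
  by_cases hpd : (p : ℤ) ∣ d
  · rcases Nat.eq_zero_or_pos k with rfl | hk
    · rw [zero_add, pow_one, pow_zero, card_sqrtsMod_prime_of_dvd h4 hp hpd, card_sqrtsMod_one h4]
      norm_num
    · rw [card_sqrtsMod_prime_pow_of_dvd hfd hp (by omega) hpd]
      simp only [Nat.cast_zero]
      positivity
  by_cases hP : p ∈ kroneckerOnePrimes d
  · rw [card_sqrtsMod_prime_pow_of_mem h4 (by omega) hP]
    rcases Nat.eq_zero_or_pos k with rfl | hk
    · rw [pow_zero, card_sqrtsMod_one h4]; norm_num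
    · rw [card_sqrtsMod_prime_pow_of_mem h4 hk hP]; norm_num
  · rw [card_sqrtsMod_prime_pow_of_not_mem h4 hp (by omega) hpd hP]
    simp only [Nat.cast_zero]
    positivity

/-- `ρ_d(p^k) ≤ 2` (`k ≥ 1`), real form. [cite: GoldfeldSchinzel1975, §2 proof of Lemma 1 (4) p. 573] -/
theorem rho_prime_pow_le_two {d : ℤ}
    (hfd : (d % 4 = 1 ∧ Squarefree d ∧ d ≠ 1) ∨
      (4 ∣ d ∧ (d / 4 % 4 = 2 ∨ d / 4 % 4 = 3) ∧ Squarefree (d / 4)))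
    (p k : ℕ) (hp : p.Prime) (_hk : 1 ≤ k) : rho d (p ^ k) ≤ 2 := by
  rw [rho_apply]
  exact_mod_cast card_sqrtsMod_prime_pow_le_two hfd hp k

/-! ### The Kronecker character of the field: values at primes and quadraticity -/

/-- From the Kronecker values `κ(p) = (d/p)` (odd `p`) and the mod-8 rule at `2` to the three cases
`p ∣ d`, `p ∈ 𝒫_d`, inert used by `DiscRootCount.charDivisorSum_eq_sqInd_mul_rho`.
[cite: GoldfeldSchinzel1975, §2 proof of Lemma 1 p. 572–573] -/
theorem kronecker_prime_values {d : ℤ}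
    (hfd : (d % 4 = 1 ∧ Squarefree d ∧ d ≠ 1) ∨
      (4 ∣ d ∧ (d / 4 % 4 = 2 ∨ d / 4 % 4 = 3) ∧ Squarefree (d / 4)))
    {N : ℕ} [NeZero N] (κ : DirichletCharacter ℂ N)
    (hoddp : ∀ p : ℕ, p.Prime → p ≠ 2 → κ p = (jacobiSym d p : ℂ))
    (htwo : κ 2 = if d % 8 = 1 then 1 else if d % 8 = 5 then -1 else 0) :
    (∀ p : ℕ, p.Prime → (p : ℤ) ∣ d → κ (p : ZMod N) = 0) ∧
    (∀ p ∈ kroneckerOnePrimes d, κ (p : ZMod N) = 1) ∧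
    (∀ p : ℕ, p.Prime → ¬ (p : ℤ) ∣ d → p ∉ kroneckerOnePrimes d → κ (p : ZMod N) = -1) := by
  have h4 := emod_four_of_isFundamental hfd
  refine ⟨fun p hp hpd => ?_, fun p hP => ?_, fun p hp hpd hP => ?_⟩
  · by_cases hp2 : p = 2
    · subst hp2
      have h8 : ¬ d % 8 = 1 := by obtain ⟨c, hc⟩ := hpd; omega
      have h8' : ¬ d % 8 = 5 := by obtain ⟨c, hc⟩ := hpd; omega
      rw [Nat.cast_ofNat, htwo, if_neg h8, if_neg h8']
    · rw [hoddp p hp hp2, jacobiSym_eq_zero_of_prime_dvd hp hpd]; simp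
  · have hp := prime_of_mem_kroneckerOnePrimes hP
    by_cases hp2 : p = 2
    · subst hp2
      have h8 := two_mem_kroneckerOnePrimes_iff.mp hP
      rw [Nat.cast_ofNat, htwo, if_pos h8]
    · rw [hoddp p hp hp2, jacobiSym_eq_one_of_mem_kroneckerOnePrimes h4 hp2 hP]; simp
  · by_cases hp2 : p = 2
    · subst hp2
      have h8 : ¬ d % 8 = 1 := fun h => hP (two_mem_kroneckerOnePrimes_iff.mpr h)
      have hodd : ¬ (2 : ℤ) ∣ d := by exact_mod_cast hpd
      have h5 : d % 8 = 5 := by omega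
      rw [Nat.cast_ofNat, htwo, if_neg h8, if_pos h5]
    · rw [hoddp p hp hp2, jacobiSym_eq_neg_one_of_not_mem_kroneckerOnePrimes h4 hp hp2 hpd hP]; simp

/-- A Dirichlet character with values `0, ±1` at every prime is quadratic (`κ² = 1`).
[cite: GoldfeldSchinzel1975, §2 proof of Lemma 1 p. 572–573] -/
theorem sq_eq_one_of_prime_values {N : ℕ} [NeZero N] (hN : 1 < N) (κ : DirichletCharacter ℂ N)
    (hp : ∀ p : ℕ, p.Prime → κ (p : ZMod N) = 0 ∨ κ (p : ZMod N) = 1 ∨ κ (p : ZMod N) = -1) :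
    κ ^ 2 = 1 := by
  have hnat : ∀ n : ℕ, κ (n : ZMod N) = 0 ∨ κ (n : ZMod N) = 1 ∨ κ (n : ZMod N) = -1 := by
    intro n
    induction n using Nat.recOnPosPrimePosCoprime with
    | zero =>
      left
      haveI : Nontrivial (ZMod N) := ZMod.nontrivial_iff.mpr hN.ne'
      rw [Nat.cast_zero]
      exact MulChar.map_nonunit κ not_isUnit_zero
    | one => right; left; simp
    | prime_pow p k hpp hk =>
      rw [Nat.cast_pow, map_pow]
      rcases hp p hpp with h | h | h <;> rw [h]
      · left; exact zero_pow hk.ne'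
      · right; left; simp
      · rcases Nat.even_or_odd k with he | ho
        · right; left; exact he.neg_one_pow
        · right; right; exact ho.neg_one_pow
    | coprime a b _ _ _ iha ihb =>
      rw [Nat.cast_mul, map_mul]
      rcases iha with ha | ha | ha <;> rcases ihb with hb | hb | hb <;> simp [ha, hb]
  refine MulChar.IsQuadratic.sq_eq_one fun a => ?_
  have : a = ((a.val : ℕ) : ZMod N) := (ZMod.natCast_zmod_val a).symm
  rw [this]
  exact hnat a.val

/-! ### The ideal side: `Σ_{N𝔞 ≤ x} 1/N𝔞 = Σ_{n ≤ x} #{𝔞 : N𝔞 = n}/n` -/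

/-- Grouping the ideals of norm `≤ x` by their norm. [cite: GoldfeldSchinzel1975, §2 proof of Lemma 1 (3) p. 573] -/
theorem sum_inv_absNorm_eq_sum_card {K : Type*} [Field K] [NumberField K] {x : ℝ} (hx : 0 ≤ x)
    (S : Finset (Ideal (NumberField.RingOfIntegers K)))
    (hS : ∀ I : Ideal (NumberField.RingOfIntegers K), I ∈ S ↔ I ≠ ⊥ ∧ (Ideal.absNorm I : ℝ) ≤ x) :
    ∑ I ∈ S, (1 : ℝ) / (Ideal.absNorm I : ℝ) =
      ∑ n ∈ Ioc 0 ⌊x⌋₊,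
        (Nat.card {I : Ideal (NumberField.RingOfIntegers K) // Ideal.absNorm I = n} : ℝ) / (n : ℝ) := by
  have hmaps : ∀ I ∈ S, Ideal.absNorm I ∈ Ioc 0 ⌊x⌋₊ := by
    intro I hI
    obtain ⟨hI0, hIx⟩ := (hS I).mp hI
    rw [mem_Ioc]
    refine ⟨Nat.pos_of_ne_zero (fun h => hI0 (Ideal.absNorm_eq_zero_iff.mp h)), Nat.le_floor hIx⟩
  rw [← sum_fiberwise_of_maps_to hmaps]
  refine sum_congr rfl fun n hn => ?_
  have hn0 : 0 < n := (mem_Ioc.mp hn).1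
  have hnx : (n : ℝ) ≤ x := by
    have h1 : (n : ℝ) ≤ ⌊x⌋₊ := by exact_mod_cast (mem_Ioc.mp hn).2
    exact h1.trans (Nat.floor_le hx)
  -- on the fibre the summand is constant `1/n`, and the fibre is all ideals of norm `n`
  have hfib : ∑ I ∈ S.filter (fun I => Ideal.absNorm I = n), (1 : ℝ) / (Ideal.absNorm I : ℝ) =
      ∑ I ∈ S.filter (fun I => Ideal.absNorm I = n), (1 : ℝ) / (n : ℝ) := by
    refine sum_congr rfl fun I hI => ?_
    rw [(mem_filter.mp hI).2]
  rw [hfib, sum_const, nsmul_eq_mul]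
  have hfin : {I : Ideal (NumberField.RingOfIntegers K) | Ideal.absNorm I = n}.Finite :=
    Ideal.finite_setOf_absNorm_eq n
  have hcard : (S.filter (fun I => Ideal.absNorm I = n)).card =
      Nat.card {I : Ideal (NumberField.RingOfIntegers K) // Ideal.absNorm I = n} := by
    have hset : hfin.toFinset = S.filter (fun I => Ideal.absNorm I = n) := by
      ext I
      rw [Set.Finite.mem_toFinset, Set.mem_setOf_eq, mem_filter]
      constructor
      · intro h
        refine ⟨(hS I).mpr ⟨?_, ?_⟩, h⟩
        · intro hb
          rw [hb, Ideal.absNorm_bot] at h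
          omega
        · rw [h]; exact hnx
      · exact fun h => h.2
    rw [← hset, ← Set.ncard_eq_toFinset_card _ hfin, ← Nat.card_coe_set_eq]
    rfl
  rw [hcard]
  ring


/-! ### The core two-sided estimate (parameters `l`, `x` free), character level -/

open Literature.NumberTheory.LFunctions.Mertens (meisselMertens) in
open Literature.NumberTheory.Sieve (RankinComposed.C₀) in
/-- **(3) + (4) + (5) with free parameters, for a real character attached to the fundamental
discriminant `D`.** With `Δ = |D| ≥ 17`, `M = ⌊√((Δ − 1)/16)⌋` (so `Σ' = Σ_{a ≤ M} ρ_D(a)/a ≥ 1`),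
`l ≥ 16` and `M + 1 ≤ x ≤ l (M + 1)`: `T = Σ_{n ≤ x} r(n)/n` (`r = 1 ∗ χ`) satisfies
`T ≤ (π²/6)(Σ'(1 + 2W) + R)` and `T ≥ (π²/6 − 1/⌊√(⌊x⌋/M)⌋) Σ'`, with
`W = (log(2x/(M+1)) + 16)/log(l/2)` and `R = (M+1)^{−1/log l} e^{2(log log l + K₀)}`.
[cite: GoldfeldSchinzel1975, §2 proof of Lemma 1 (3)–(5) pp. 573–575] -/
theorem char_core {D : ℤ}
    (hfd : (D % 4 = 1 ∧ Squarefree D ∧ D ≠ 1) ∨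
      (4 ∣ D ∧ (D / 4 % 4 = 2 ∨ D / 4 % 4 = 3) ∧ Squarefree (D / 4)))
    {q : ℕ} [NeZero q] (χ : DirichletCharacter ℂ q) (hq : χ ^ 2 = 1)
    (h0 : ∀ p : ℕ, p.Prime → (p : ℤ) ∣ D → χ (p : ZMod q) = 0)
    (h1 : ∀ p ∈ kroneckerOnePrimes D, χ (p : ZMod q) = 1)
    (h2 : ∀ p : ℕ, p.Prime → ¬ (p : ℤ) ∣ D → p ∉ kroneckerOnePrimes D → χ (p : ZMod q) = -1)
    (hΔ : 17 ≤ D.natAbs) {l : ℕ} (hl : 16 ≤ l) {x : ℝ}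
    (hxZ : (Nat.sqrt ((D.natAbs - 1) / 16) : ℝ) + 1 ≤ x)
    (hxl : x ≤ l * ((Nat.sqrt ((D.natAbs - 1) / 16) : ℝ) + 1)) :
    1 ≤ formSum D ∧
    (∑ n ∈ Ioc 0 ⌊x⌋₊, charDivisorSum χ n / (n : ℝ)) ≤ Real.pi ^ 2 / 6 *
        (formSum D *
          (1 + 2 * ((Real.log (2 * x / ((Nat.sqrt ((D.natAbs - 1) / 16) : ℝ) + 1))
            + 16) / Real.log ((l : ℝ) / 2))) +
          ((Nat.sqrt ((D.natAbs - 1) / 16) : ℝ) + 1) ^ (-(1 / Real.log l)) *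
            Real.exp (2 * (Real.log (Real.log l) +
              (meisselMertens + 8 / Real.log 16 + 3 + 24 * Real.exp 1 + RankinComposed.C₀)))) ∧
    (Real.pi ^ 2 / 6 - 1 / (Nat.sqrt (⌊x⌋₊ / Nat.sqrt ((D.natAbs - 1) / 16)) : ℝ)) *
        formSum D ≤ ∑ n ∈ Ioc 0 ⌊x⌋₊, charDivisorSum χ n / (n : ℝ) := by
  have h4 := emod_four_of_isFundamental hfd
  set M : ℕ := Nat.sqrt ((D.natAbs - 1) / 16) with hM
  set N : ℕ := ⌊x⌋₊ with hN
  have hFS : formSum D = ∑ a ∈ Ioc 0 M, rho D a / (a : ℝ) := formSum_eq_sum_rho _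
  have hFS1 : 1 ≤ ∑ a ∈ Ioc 0 M, rho D a / (a : ℝ) := one_le_sum_rho h4 hΔ
  have hM1 : 1 ≤ M := by rw [hM, Nat.le_sqrt, Nat.le_div_iff_mul_le (by norm_num)]; omega
  have hMN : M ≤ N := by
    rw [hN]; refine Nat.le_floor ?_; linarith
  refine ⟨hFS ▸ hFS1, ?_, ?_⟩
  · -- upper bound
    have hup := sum_charDivisorSum_div_le χ hfd hq h0 h1 h2 N
    have hsplit : ∑ a ∈ Ioc 0 N, rho D a / (a : ℝ) =
        ∑ a ∈ Ioc 0 M, rho D a / (a : ℝ) + ∑ a ∈ Ioc M N, rho D a / (a : ℝ) :=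
      (sum_Ioc_consecutive _ (Nat.zero_le M) hMN).symm
    have htail_set : Ioc M N = (Icc 1 N).filter (fun a : ℕ => (M : ℝ) + 1 ≤ (a : ℝ)) := by
      ext a
      simp only [mem_Ioc, mem_filter, mem_Icc]
      constructor
      · rintro ⟨h1a, h2a⟩; exact ⟨⟨by omega, h2a⟩, by exact_mod_cast h1a⟩
      · rintro ⟨⟨-, h2a⟩, h1a⟩
        have : M + 1 ≤ a := by exact_mod_cast h1a
        exact ⟨by omega, h2a⟩
    have hZ1 : (1 : ℝ) ≤ (M : ℝ) + 1 := by
      have : (0 : ℝ) ≤ M := Nat.cast_nonneg M; linarith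
    have htail := GSTail.tail_le (isMultiplicative_rho h4) (rho_nonneg D)
      (rho_prime_pow_succ_le hfd) (rho_prime_pow_le_two hfd) hl hZ1 hxZ hxl
    have hceil : ⌈(M : ℝ) + 1⌉₊ = M + 1 := by
      rw [show (M : ℝ) + 1 = ((M + 1 : ℕ) : ℝ) by push_cast; ring, Nat.ceil_natCast]
    have hIco : Ico 1 (M + 1) = Ioc 0 M := by ext a; simp only [mem_Ico, mem_Ioc]; omega
    rw [hceil, hIco, ← hN, ← htail_set] at htail
    rw [hFS]
    refine hup.trans ?_
    rw [hsplit]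
    refine mul_le_mul_of_nonneg_left ?_ (by positivity)
    have hRnn : 0 ≤ ((M : ℝ) + 1) ^ (-(1 / Real.log l)) *
        Real.exp (2 * (Real.log (Real.log l) +
          (meisselMertens + 8 / Real.log 16 + 3 + 24 * Real.exp 1 + RankinComposed.C₀))) :=
      mul_nonneg (Real.rpow_nonneg (by linarith) _) (Real.exp_pos _).le
    nlinarith [htail]
  · -- lower bound
    rw [hFS]
    exact sum_charDivisorSum_div_ge χ hfd hq h0 h1 h2 hM1 hMN

open Literature.NumberTheory.LFunctions.Mertens (meisselMertens) in
open Literature.NumberTheory.Sieve (RankinComposed.C₀) in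
/-- **(3) + (4) + (5) with free parameters, for the ideals of a quadratic field** (`char_core` for
the Kronecker character, the ideal count being `#{𝔞 : N𝔞 = n} = (1 ∗ χ_d)(n)`): writing
`T = Σ_{N𝔞 ≤ x} 1/N𝔞`, `T ≤ (π²/6)(Σ'(1 + 2W) + R)` and `T ≥ (π²/6 − 1/⌊√(⌊x⌋/M)⌋) Σ'`.
[cite: GoldfeldSchinzel1975, §2 proof of Lemma 1 (3)–(5) pp. 573–575] -/
theorem lemma1_core {K : Type*} [Field K] [NumberField K] (h2 : Module.finrank ℚ K = 2)
    (hΔ : 17 ≤ (NumberField.discr K).natAbs) {l : ℕ} (hl : 16 ≤ l) {x : ℝ}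
    (hxZ : (Nat.sqrt (((NumberField.discr K).natAbs - 1) / 16) : ℝ) + 1 ≤ x)
    (hxl : x ≤ l * ((Nat.sqrt (((NumberField.discr K).natAbs - 1) / 16) : ℝ) + 1))
    (S : Finset (Ideal (NumberField.RingOfIntegers K)))
    (hS : ∀ I : Ideal (NumberField.RingOfIntegers K), I ∈ S ↔ I ≠ ⊥ ∧ (Ideal.absNorm I : ℝ) ≤ x) :
    1 ≤ formSum (NumberField.discr K) ∧
    (∑ I ∈ S, (1 : ℝ) / (Ideal.absNorm I : ℝ)) ≤ Real.pi ^ 2 / 6 *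
        (formSum (NumberField.discr K) *
          (1 + 2 * ((Real.log (2 * x / ((Nat.sqrt (((NumberField.discr K).natAbs - 1) / 16) : ℝ) + 1))
            + 16) / Real.log ((l : ℝ) / 2))) +
          ((Nat.sqrt (((NumberField.discr K).natAbs - 1) / 16) : ℝ) + 1) ^ (-(1 / Real.log l)) *
            Real.exp (2 * (Real.log (Real.log l) +
              (meisselMertens + 8 / Real.log 16 + 3 + 24 * Real.exp 1 + RankinComposed.C₀)))) ∧
    (Real.pi ^ 2 / 6 - 1 / (Nat.sqrt (⌊x⌋₊ / Nat.sqrt (((NumberField.discr K).natAbs - 1) / 16)) : ℝ)) *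
        formSum (NumberField.discr K) ≤ ∑ I ∈ S, (1 : ℝ) / (Ideal.absNorm I : ℝ) := by
  have hfd := Literature.NumberTheory.QuadraticFields.Quadratic.isFundamentalDiscriminant_discr (K := K) h2
  haveI : NeZero (NumberField.discr K).natAbs := ⟨by omega⟩
  -- the Kronecker character
  obtain ⟨κ, hoddp, htwo⟩ := Literature.NumberTheory.QuadraticFields.exists_kroneckerChar (K := K) h2
  obtain ⟨h0, h1, h2'⟩ := kronecker_prime_values hfd κ hoddp htwo
  have hq : κ ^ 2 = 1 := by
    refine sq_eq_one_of_prime_values (by omega) κ fun p hp => ?_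
    by_cases hpd : (p : ℤ) ∣ NumberField.discr K
    · exact Or.inl (h0 p hp hpd)
    by_cases hP : p ∈ kroneckerOnePrimes (NumberField.discr K)
    · exact Or.inr (Or.inl (h1 p hP))
    · exact Or.inr (Or.inr (h2' p hp hpd hP))
  have hζ : ∀ s : ℂ, 1 < s.re →
      NumberField.dedekindZeta K s = riemannZeta s * LSeries (fun n => κ n) s := fun s hs =>
    Literature.NumberTheory.QuadraticFields.Quadratic.dedekindZeta_eq_riemannZeta_mul_LSeries_of_kronecker
      (K := K) h2 κ hoddp htwo hs
  -- the ideal sum is `T(N) = ∑_{n ≤ N} r(n)/n`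
  have hx0 : 0 ≤ x := le_trans (by positivity) hxZ
  have hT : ∑ I ∈ S, (1 : ℝ) / (Ideal.absNorm I : ℝ) =
      ∑ n ∈ Ioc 0 ⌊x⌋₊, charDivisorSum κ n / (n : ℝ) := by
    rw [sum_inv_absNorm_eq_sum_card hx0 S hS]
    refine sum_congr rfl fun n hn => ?_
    have hn0 : n ≠ 0 := (mem_Ioc.mp hn).1.ne'
    rw [Literature.NumberTheory.DiophantineGeometry.charDivisorSum_eq_card (K := K) hq hζ hn0]
  rw [hT]
  exact char_core hfd κ hq h0 h1 h2' hΔ hl hxZ hxl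

/-! ### Numerical bookkeeping for `l = ⌈exp(log Δ / (8 log log Δ))⌉`, `x = ¼√Δ · f(Δ)^{1 or 2}`

These lemmas are shared with the proof of Theorem 1 (`x = ¼√Δ f(Δ)²` there), whence the fourth
powers. -/

/-- `32u² ≤ eᵘ` for `u ≥ 100`. [folklore] -/
private theorem thirtytwo_sq_le_exp {u : ℝ} (hu : 100 ≤ u) : 32 * u ^ 2 ≤ Real.exp u := by
  have h := Real.pow_div_factorial_le_exp u (by linarith) 4
  have h4 : ((Nat.factorial 4 : ℕ) : ℝ) = 24 := by norm_num [Nat.factorial]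
  rw [h4] at h
  have hu2 : 10000 ≤ u ^ 2 := by nlinarith
  have he : u ^ 4 = u ^ 2 * u ^ 2 := by ring
  nlinarith

/-- `M ≤ ¼√Δ ≤ M + 1` for `M = ⌊√((Δ − 1)/16)⌋` ("`a < ¼√|d|`").
[cite: GoldfeldSchinzel1975, §2 Lemma 1 p. 572] -/
theorem sqrt_window (Δ : ℕ) (hΔ : 1 ≤ Δ) :
    (Nat.sqrt ((Δ - 1) / 16) : ℝ) ≤ Real.sqrt Δ / 4 ∧
      Real.sqrt Δ / 4 ≤ (Nat.sqrt ((Δ - 1) / 16) : ℝ) + 1 := by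
  set M := Nat.sqrt ((Δ - 1) / 16) with hM
  have h1 : M ^ 2 ≤ (Δ - 1) / 16 := Nat.sqrt_le' _
  have h2 : (Δ - 1) / 16 < (M + 1) ^ 2 := Nat.lt_succ_sqrt' _
  have h1' : 16 * M ^ 2 ≤ Δ := by omega
  have h2' : Δ ≤ 16 * (M + 1) ^ 2 := by omega
  have h1r : (16 : ℝ) * (M : ℝ) ^ 2 ≤ Δ := by exact_mod_cast h1'
  have h2r : (Δ : ℝ) ≤ 16 * ((M : ℝ) + 1) ^ 2 := by exact_mod_cast h2'
  constructor
  · rw [le_div_iff₀ (by norm_num : (0 : ℝ) < 4), Real.le_sqrt (by positivity) (by positivity)]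
    nlinarith
  · rw [div_le_iff₀ (by norm_num : (0 : ℝ) < 4)]
    calc Real.sqrt Δ ≤ Real.sqrt ((((M : ℝ) + 1) * 4) ^ 2) := Real.sqrt_le_sqrt (by nlinarith)
      _ = ((M : ℝ) + 1) * 4 := Real.sqrt_sq (by positivity)

/-- **The window term of (4)**: with `L = log Δ`, `u = log L ≥ 100`, `32u² ≤ L = eᵘ`,
`0 < w ≤ 2 (L/u)⁴` and `l ≥ exp(L/(8u))`:
`(log w + 16)/log(l/2) ≤ 80 u²/L` — the source's `S₁ ≪ Σ' · (log log d)²/log d`.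
[cite: GoldfeldSchinzel1975, §2 proof of Lemma 1 (4) p. 574] -/
theorem window_bound {u Lr w lr : ℝ} (hu : 100 ≤ u) (hLu : 32 * u ^ 2 ≤ Lr)
    (hLexp : Lr = Real.exp u) (hw0 : 0 < w) (hw : w ≤ 2 * (Lr / u) ^ 4)
    (hlE : Real.exp (Lr / (8 * u)) ≤ lr) :
    0 < Real.log (lr / 2) ∧ (Real.log w + 16) / Real.log (lr / 2) ≤ 80 * (u ^ 2 / Lr) := by
  have hu0 : 0 < u := by linarith
  have hLr0 : 0 < Lr := by nlinarith
  have hsu : u ≤ Lr / (16 * u) := by rw [le_div_iff₀ (by positivity)]; nlinarith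
  have hl2 : Real.log 2 < 1 := by linarith [Real.log_two_lt_d9]
  -- numerator
  have hnum : Real.log w + 16 ≤ 5 * u := by
    have h1 : Real.log w ≤ Real.log (2 * (Lr / u) ^ 4) := Real.log_le_log hw0 hw
    have h2 : Real.log (2 * (Lr / u) ^ 4) = Real.log 2 + 4 * Real.log (Lr / u) := by
      rw [Real.log_mul (by norm_num) (by positivity), Real.log_pow]; push_cast; ring
    have h3 : Real.log (Lr / u) ≤ u := by
      rw [Real.log_le_iff_le_exp (by positivity), ← hLexp, div_le_iff₀ hu0]
      nlinarith
    linarith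
  -- denominator
  have hE0 : 0 < Real.exp (Lr / (8 * u)) := Real.exp_pos _
  have hlr0 : 0 < lr := lt_of_lt_of_le hE0 hlE
  have hden : Lr / (16 * u) ≤ Real.log (lr / 2) := by
    have h1 : Real.log (Real.exp (Lr / (8 * u)) / 2) ≤ Real.log (lr / 2) :=
      Real.log_le_log (by positivity) (by linarith)
    have h2 : Real.log (Real.exp (Lr / (8 * u)) / 2) = Lr / (8 * u) - Real.log 2 := by
      rw [Real.log_div hE0.ne' (by norm_num), Real.log_exp]
    have h5 : Lr / (8 * u) = 2 * (Lr / (16 * u)) := by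
      field_simp; ring
    linarith
  have hden0 : 0 < Real.log (lr / 2) := lt_of_lt_of_le (by positivity) hden
  refine ⟨hden0, ?_⟩
  have hden' : Lr ≤ 16 * u * Real.log (lr / 2) := by
    have := hden; rwa [div_le_iff₀ (by positivity), mul_comm] at this
  rw [div_le_iff₀ hden0, show 80 * (u ^ 2 / Lr) * Real.log (lr / 2) =
    (80 * u ^ 2 * Real.log (lr / 2)) / Lr by ring, le_div_iff₀ hLr0]
  nlinarith [mul_le_mul_of_nonneg_right hnum hLr0.le,
    mul_le_mul_of_nonneg_left hden' (by positivity : (0 : ℝ) ≤ 5 * u)]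

/-- **The remainder of (5)**: with `L = log Δ`, `u = log L ≥ 100`, `32u² ≤ L = eᵘ`,
`log Z ≥ L/2 − log 4` and `exp(L/(8u)) ≤ l ≤ exp(L/(8u)) + 1`:
`Z^{−1/log l} e^{2(log log l + K₀)} ≤ e^{2K₀}/L` — the source's `S₂ ≪ (log d)^{-3}`.
[cite: GoldfeldSchinzel1975, §2 proof of Lemma 1 (5) p. 575] -/
theorem remainder_bound {u Lr Z lr K₀ : ℝ} (hu : 100 ≤ u) (hLu : 32 * u ^ 2 ≤ Lr)
    (hLexp : Lr = Real.exp u) (hZ0 : 0 < Z) (hZ : Lr / 2 - Real.log 4 ≤ Real.log Z)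
    (hlE : Real.exp (Lr / (8 * u)) ≤ lr) (hlE' : lr ≤ Real.exp (Lr / (8 * u)) + 1) :
    Z ^ (-(1 / Real.log lr)) * Real.exp (2 * (Real.log (Real.log lr) + K₀)) ≤
      Real.exp (2 * K₀) / Lr := by
  have hu0 : 0 < u := by linarith
  have hLr0 : 0 < Lr := by nlinarith
  set E := Real.exp (Lr / (8 * u)) with hE
  have hE0 : 0 < E := Real.exp_pos _
  have hlr0 : 0 < lr := lt_of_lt_of_le hE0 hlE
  have h8 : 2 * u ≤ Lr / (8 * u) := by rw [le_div_iff₀ (by positivity)]; nlinarith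
  have hL8 : u * (Lr / (8 * u)) = Lr / 8 := by field_simp
  have hl2 : Real.log 2 < 1 := by linarith [Real.log_two_lt_d9]
  -- `log l` is pinned between `Lr/(8u)` and `Lr/(8u) + 1`
  have hlog_lo : Lr / (8 * u) ≤ Real.log lr := by
    rw [Real.le_log_iff_exp_le hlr0]; exact hlE
  have hlog_hi : Real.log lr ≤ Lr / (8 * u) + 1 := by
    have h1 : lr ≤ 2 * E := by
      have := Real.add_one_le_exp (Lr / (8 * u)); linarith
    have h2 : Real.log lr ≤ Real.log (2 * E) := Real.log_le_log hlr0 h1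
    rw [Real.log_mul (by norm_num) hE0.ne', hE, Real.log_exp] at h2
    linarith
  have hlog0 : 0 < Real.log lr := by linarith
  -- the `rpow` factor is at most `1/Lr³`
  have hrpow : Z ^ (-(1 / Real.log lr)) ≤ 1 / Lr ^ 3 := by
    rw [Real.rpow_def_of_pos hZ0]
    have hq : 3 * u ≤ Real.log Z * (1 / Real.log lr) := by
      rw [mul_one_div, le_div_iff₀ hlog0]
      have hlog4 : Real.log 4 < 2 := by
        have : Real.log 4 = 2 * Real.log 2 := by
          rw [show (4 : ℝ) = 2 ^ 2 by norm_num, Real.log_pow]; push_cast; ring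
        linarith
      have h1 := mul_le_mul_of_nonneg_left hlog_hi (by positivity : (0 : ℝ) ≤ 3 * u)
      nlinarith
    have hneg : Real.log Z * -(1 / Real.log lr) = -(Real.log Z * (1 / Real.log lr)) :=
      mul_neg _ _
    calc Real.exp (Real.log Z * -(1 / Real.log lr))
        ≤ Real.exp (-(3 * u)) := Real.exp_le_exp.mpr (by linarith)
      _ = 1 / Lr ^ 3 := by
        rw [Real.exp_neg, show (3 : ℝ) * u = ((3 : ℕ) : ℝ) * u by norm_num, Real.exp_nat_mul,
          ← hLexp, one_div]
  -- the exponential factor is `(log l)² e^{2K₀} ≤ Lr² e^{2K₀}`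
  have hexp : Real.exp (2 * (Real.log (Real.log lr) + K₀)) ≤ Lr ^ 2 * Real.exp (2 * K₀) := by
    rw [mul_add, Real.exp_add, show (2 : ℝ) * Real.log (Real.log lr) =
      ((2 : ℕ) : ℝ) * Real.log (Real.log lr) by norm_num, Real.exp_nat_mul, Real.exp_log hlog0]
    refine mul_le_mul_of_nonneg_right (pow_le_pow_left₀ hlog0.le ?_ 2) (Real.exp_pos _).le
    have : Lr / (8 * u) ≤ Lr / 8 := by
      rw [div_le_div_iff₀ (by positivity) (by norm_num)]; nlinarith
    linarith
  calc Z ^ (-(1 / Real.log lr)) * Real.exp (2 * (Real.log (Real.log lr) + K₀))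
      ≤ 1 / Lr ^ 3 * (Lr ^ 2 * Real.exp (2 * K₀)) :=
        mul_le_mul hrpow hexp (Real.exp_pos _).le (by positivity)
    _ = Real.exp (2 * K₀) / Lr := by field_simp

/-- **Sizes forced by `Δ ≥ D₀ = ⌈exp(exp 100)⌉`** (the source's "`|d| > D₀`"): with `L = log Δ`,
`u = log L` one has `u ≥ 100`, `L = eᵘ ≥ 32u²`, `Δ ≥ 17`, `¼√Δ ≥ 1`, `log(¼√Δ) = L/2 − log 4`
and `(L/u)⁴ ≤ 4 √Δ` (so that `x = ¼√Δ f² ≤ Δ`).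
[cite: GoldfeldSchinzel1975, §2 Lemma 1 p. 572] -/
theorem sizes {Δ : ℕ} (hD : ⌈Real.exp (Real.exp 100)⌉₊ ≤ Δ) :
    0 < Real.log (Δ : ℝ) ∧ 100 ≤ Real.log (Real.log (Δ : ℝ)) ∧
      Real.log (Δ : ℝ) = Real.exp (Real.log (Real.log (Δ : ℝ))) ∧
      32 * Real.log (Real.log (Δ : ℝ)) ^ 2 ≤ Real.log (Δ : ℝ) ∧ 17 ≤ Δ ∧
      1 ≤ Real.sqrt (Δ : ℝ) / 4 ∧
      Real.log (Real.sqrt (Δ : ℝ) / 4) = Real.log (Δ : ℝ) / 2 - Real.log 4 ∧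
      Real.sqrt (Δ : ℝ) / 4 * (Real.log (Δ : ℝ) / Real.log (Real.log (Δ : ℝ))) ^ 4 ≤ Δ := by
  have hΔr : Real.exp (Real.exp 100) ≤ (Δ : ℝ) :=
    le_trans (Nat.le_ceil _) (by exact_mod_cast hD)
  have hΔ0 : (0 : ℝ) < Δ := lt_of_lt_of_le (Real.exp_pos _) hΔr
  set Lr := Real.log (Δ : ℝ) with hLr
  have hLr100 : Real.exp 100 ≤ Lr := (Real.le_log_iff_exp_le hΔ0).mpr hΔr
  have hLr0 : 0 < Lr := lt_of_lt_of_le (Real.exp_pos _) hLr100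
  have hu100 : 100 ≤ Real.log Lr := (Real.le_log_iff_exp_le hLr0).mpr hLr100
  have hu1 : 1 ≤ Real.log Lr := by linarith
  have hLexp : Lr = Real.exp (Real.log Lr) := (Real.exp_log hLr0).symm
  have h17 : (17 : ℝ) ≤ Δ := by
    have h1 := Real.add_one_le_exp (100 : ℝ)
    have h2 := Real.add_one_le_exp (Real.exp 100)
    linarith
  have hΔexp : (Δ : ℝ) = Real.exp Lr := (Real.exp_log hΔ0).symm
  have hsqrt : Real.sqrt (Δ : ℝ) = Real.exp (Lr / 2) := by
    rw [hΔexp, Real.sqrt_eq_rpow, ← Real.exp_mul]; ring_nf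
  refine ⟨hLr0, hu100, hLexp, ?_, by exact_mod_cast h17, ?_, ?_, ?_⟩
  · rw [hLexp, Real.log_exp]; exact thirtytwo_sq_le_exp hu100
  · rw [le_div_iff₀ (by norm_num : (0 : ℝ) < 4), Real.le_sqrt (by norm_num) (by positivity)]
    linarith
  · rw [Real.log_div (Real.sqrt_pos.mpr hΔ0).ne' (by norm_num), Real.log_sqrt hΔ0.le]
  · -- `(L/u)⁴ ≤ L⁴ ≤ 4 e^{L/2}`: `e^{L/2} ≥ (L/2)⁵/120`
    have h1 : (Lr / Real.log Lr) ^ 4 ≤ Lr ^ 4 := by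
      have : Lr / Real.log Lr ≤ Lr := by
        rw [div_le_iff₀ (by linarith)]; nlinarith
      exact pow_le_pow_left₀ (div_nonneg hLr0.le (by linarith)) this 4
    have h2 : (Lr / 2) ^ 5 / ((Nat.factorial 5 : ℕ) : ℝ) ≤ Real.exp (Lr / 2) :=
      Real.pow_div_factorial_le_exp (Lr / 2) (by linarith) 5
    have h5 : ((Nat.factorial 5 : ℕ) : ℝ) = 120 := by norm_num [Nat.factorial]
    rw [h5] at h2
    have hL3840 : 3840 ≤ Lr := by
      have h := Real.pow_div_factorial_le_exp (100 : ℝ) (by norm_num) 2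
      have h2' : ((Nat.factorial 2 : ℕ) : ℝ) = 2 := by norm_num [Nat.factorial]
      rw [h2'] at h
      norm_num at h
      linarith
    have h3 : Lr ^ 4 ≤ 4 * Real.exp (Lr / 2) := by
      have : Lr ^ 5 / 3840 ≤ Real.exp (Lr / 2) := by
        have e : (Lr / 2) ^ 5 / 120 = Lr ^ 5 / 3840 := by ring
        linarith [e ▸ h2]
      have h4 : Lr ^ 4 * Lr ≤ 3840 * Real.exp (Lr / 2) := by
        rw [← pow_succ]; rw [div_le_iff₀ (by norm_num)] at this; linarith
      nlinarith [Real.exp_pos (Lr / 2), pow_nonneg hLr0.le 4]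
    rw [hsqrt, hΔexp]
    have h6 : Real.exp Lr = Real.exp (Lr / 2) * Real.exp (Lr / 2) := by
      rw [← Real.exp_add]; ring_nf
    rw [h6]
    have hE2 : 0 < Real.exp (Lr / 2) := Real.exp_pos _
    calc Real.exp (Lr / 2) / 4 * (Lr / Real.log Lr) ^ 4
        ≤ Real.exp (Lr / 2) / 4 * (4 * Real.exp (Lr / 2)) :=
          mul_le_mul_of_nonneg_left (h1.trans h3) (by positivity)
      _ = Real.exp (Lr / 2) * Real.exp (Lr / 2) := by ring

/-- **The parameter bookkeeping** (the source's choices `l = d^{1/(21 log log d)}`,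
`x = ¼√|d| f(d)`, here `l = ⌈exp(L/(8u))⌉`): with `s = L/u`, `E = exp(L/(8u))`, `l = ⌈E⌉`,
`M ≤ A ≤ M + 1`, `A ≥ 1`: `s ≥ 4`, `l ≥ 16`, `M + 1 ≤ A s² ≤ A s⁴ ≤ l (M + 1)`, `2/s ≤ 2u²/L`.
[cite: GoldfeldSchinzel1975, §2 proof of Lemma 1 pp. 574–575] -/
theorem parameters {M l : ℕ} {Lr u A s E : ℝ} (hu : 100 ≤ u) (hLu : 32 * u ^ 2 ≤ Lr)
    (hLexp : Lr = Real.exp u) (hs : s = Lr / u) (hE : E = Real.exp (Lr / (8 * u)))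
    (hl : l = ⌈E⌉₊) (hA1 : 1 ≤ A) (hMA : (M : ℝ) ≤ A) (hAM : A ≤ (M : ℝ) + 1) :
    4 ≤ s ∧ 16 ≤ l ∧ Real.exp (Lr / (8 * u)) ≤ l ∧ (l : ℝ) ≤ Real.exp (Lr / (8 * u)) + 1 ∧
      (M : ℝ) + 1 ≤ A * s ^ 2 ∧ A * s ^ 2 ≤ A * s ^ 4 ∧
      A * s ^ 2 ≤ ((M : ℝ) + 1) * s ^ 2 ∧ A * s ^ 4 ≤ ((M : ℝ) + 1) * s ^ 4 ∧
      A * s ^ 4 ≤ l * ((M : ℝ) + 1) ∧ 2 / s ≤ 2 * (u ^ 2 / Lr) := by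
  have hu0 : 0 < u := by linarith
  have hLr0 : 0 < Lr := by nlinarith
  have hs16 : 32 * u ≤ s := by rw [hs, le_div_iff₀ hu0]; nlinarith
  have hs4 : 4 ≤ s := by nlinarith
  have hlE : E ≤ (l : ℝ) := by rw [hl]; exact Nat.le_ceil _
  have hE0 : 0 < E := by rw [hE]; exact Real.exp_pos _
  have hlE' : (l : ℝ) ≤ E + 1 := by rw [hl]; exact (Nat.ceil_lt_add_one hE0.le).le
  have h8 : 4 * u ≤ Lr / (8 * u) := by rw [le_div_iff₀ (by positivity)]; nlinarith
  have hs2s4 : s ^ 2 ≤ s ^ 4 := pow_le_pow_right₀ (by linarith) (by norm_num)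
  have hfE : s ^ 4 ≤ E := by
    have h1 : s ^ 4 ≤ Lr ^ 4 := by
      have : s ≤ Lr := by rw [hs, div_le_iff₀ hu0]; nlinarith
      exact pow_le_pow_left₀ (by linarith) this 4
    have h2 : Lr ^ 4 = Real.exp (4 * u) := by
      rw [hLexp, ← Real.exp_nat_mul]; norm_num
    have h3 : Real.exp (4 * u) ≤ E := by rw [hE]; exact Real.exp_le_exp.mpr h8
    linarith
  have hl16 : 16 ≤ l := by
    have : (16 : ℝ) ≤ l := by nlinarith
    exact_mod_cast this
  have hA0 : 0 < A := by linarith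
  refine ⟨hs4, hl16, hE ▸ hlE, hE ▸ hlE', ?_, mul_le_mul_of_nonneg_left hs2s4 hA0.le,
    mul_le_mul_of_nonneg_right hAM (by positivity), mul_le_mul_of_nonneg_right hAM (by positivity),
    ?_, ?_⟩
  · have : A * 16 ≤ A * s ^ 2 := mul_le_mul_of_nonneg_left (by nlinarith) hA0.le
    linarith
  · have h1 : A * s ^ 4 ≤ ((M : ℝ) + 1) * s ^ 4 := mul_le_mul_of_nonneg_right hAM (by positivity)
    have h2 : ((M : ℝ) + 1) * s ^ 4 ≤ ((M : ℝ) + 1) * l :=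
      mul_le_mul_of_nonneg_left (hfE.trans hlE) (by positivity)
    linarith
  · rw [hs, div_div_eq_mul_div, mul_div_assoc]
    refine mul_le_mul_of_nonneg_left (div_le_div_of_nonneg_right ?_ hLr0.le) (by norm_num)
    nlinarith

/-- **`1/⌊√(⌊x⌋/M)⌋ ≤ 2/s`** for `x = A s²`, `M ≤ A`, `s ≥ 2` (the `u`-truncation
`Σ_{u² ≤ x/a} 1/u² = π²/6 + O(√(a/x))` of (3)). [cite: GoldfeldSchinzel1975, §2 proof of Lemma 1 (3) p. 573] -/
theorem inv_sqrt_bound {M : ℕ} {A s x : ℝ} (hA0 : 0 < A) (hMA : (M : ℝ) ≤ A)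
    (hM0 : 0 < M) (hx : x = A * s ^ 2) (hs2 : 2 ≤ s) :
    1 / (Nat.sqrt (⌊x⌋₊ / M) : ℝ) ≤ 2 / s := by
  have h1 : ⌊x⌋₊ + 1 ≤ ⌊x⌋₊ / M * M + M := Nat.succ_le_of_lt (Nat.lt_div_mul_add hM0)
  have h2 : x < (⌊x⌋₊ : ℝ) + 1 := Nat.lt_floor_add_one x
  have h3 : x < (((⌊x⌋₊ / M : ℕ) : ℝ) + 1) * M := by
    have : ((⌊x⌋₊ + 1 : ℕ) : ℝ) ≤ ((⌊x⌋₊ / M * M + M : ℕ) : ℝ) := Nat.cast_le.mpr h1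
    push_cast at this
    linarith
  have h4 : s ^ 2 < ((⌊x⌋₊ / M : ℕ) : ℝ) + 1 := by
    have h5 : (((⌊x⌋₊ / M : ℕ) : ℝ) + 1) * M ≤ (((⌊x⌋₊ / M : ℕ) : ℝ) + 1) * A :=
      mul_le_mul_of_nonneg_left hMA (by positivity)
    have h6 : A * s ^ 2 < A * (((⌊x⌋₊ / M : ℕ) : ℝ) + 1) := by rw [← hx]; linarith
    exact lt_of_mul_lt_mul_left h6 hA0.le
  have h5 : ⌊x⌋₊ / M + 1 ≤ (Nat.sqrt (⌊x⌋₊ / M) + 1) ^ 2 :=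
    Nat.succ_le_of_lt (Nat.lt_succ_sqrt' _)
  have h6 : ((⌊x⌋₊ / M : ℕ) : ℝ) + 1 ≤ ((Nat.sqrt (⌊x⌋₊ / M) : ℝ) + 1) ^ 2 := by
    have := Nat.cast_le (α := ℝ).mpr h5
    push_cast at this
    exact this
  have h7 : s < (Nat.sqrt (⌊x⌋₊ / M) : ℝ) + 1 := by
    by_contra hcon
    have : ((Nat.sqrt (⌊x⌋₊ / M) : ℝ) + 1) ^ 2 ≤ s ^ 2 :=
      pow_le_pow_left₀ (by positivity) (not_lt.mp hcon) 2
    linarith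
  have h8 : s / 2 ≤ (Nat.sqrt (⌊x⌋₊ / M) : ℝ) := by linarith
  calc 1 / (Nat.sqrt (⌊x⌋₊ / M) : ℝ) ≤ 1 / (s / 2) := one_div_le_one_div_of_le (by linarith) h8
    _ = 2 / s := one_div_div _ _

end GoldfeldSchinzel1975

/-! ### Lemma 1 -/

set_option maxHeartbeats 400000 in
open GoldfeldSchinzel1975 in
open Literature.NumberTheory.LFunctions.Mertens (meisselMertens) in
open Literature.NumberTheory.Sieve (RankinComposed.C₀) in
/-- **Goldfeld–Schinzel 1975, Lemma 1** (discharge of `goldfeldSchinzel1975_lemma1`): for a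
quadratic field `K` of discriminant `d`, `|d| > D₀`,
`Σ_{N𝔞 ≤ ¼√|d| f(d)} 1/N𝔞 = (π²/6) Σ' (1/a) · (1 + O((log log |d|)²/log |d|))`,
`f(d) = (log |d|/log log |d|)²`, the sum `Σ'` over the reduced triples `−a < b ≤ a < ¼√|d|`,
`b² ≡ d (mod 4a)`. Constants: `C = 162 + e^{2K₀}` with
`K₀ = M + 8/log 16 + 3 + 24e + C₀` (`M` the Meissel–Mertens constant, `C₀` the Rankin-tail
constant) and `D₀ = ⌈exp(exp 100)⌉`.
[cite: GoldfeldSchinzel1975, Lemma 1 p. 572; proof §2 (3)–(5) pp. 573–575] -/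
theorem goldfeldSchinzel1975_lemma1_holds : goldfeldSchinzel1975_lemma1 := by
  refine ⟨162 + Real.exp (2 * (meisselMertens + 8 / Real.log 16 + 3 + 24 * Real.exp 1 +
    RankinComposed.C₀)), ⌈Real.exp (Real.exp 100)⌉₊, ?_⟩
  intro K _ _ h2 hD₀ S hS
  -- the core estimate, as a function of its numerical side conditions
  have hcore := fun h17 h16 hZ hl' =>
    lemma1_core (K := K) h2 h17
      (l := ⌈Real.exp (Real.log ((NumberField.discr K).natAbs : ℝ) /
        (8 * Real.log (Real.log ((NumberField.discr K).natAbs : ℝ))))⌉₊)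
      (x := Real.sqrt (NumberField.discr K).natAbs / 4 *
        (Real.log (NumberField.discr K).natAbs /
          Real.log (Real.log (NumberField.discr K).natAbs)) ^ 2) h16 hZ hl' S hS
  obtain ⟨hLr0, hu100, hLexp, hLu, hΔ17, hA1, hlogA, -⟩ := sizes hD₀
  obtain ⟨hMA, hAM⟩ := sqrt_window (NumberField.discr K).natAbs (le_trans (by norm_num) hΔ17)
  -- names
  set K₀ : ℝ := meisselMertens + 8 / Real.log 16 + 3 + 24 * Real.exp 1 + RankinComposed.C₀
    with hK₀
  set Δ : ℕ := (NumberField.discr K).natAbs with hΔ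
  set M : ℕ := Nat.sqrt ((Δ - 1) / 16) with hM
  set Lr : ℝ := Real.log (Δ : ℝ) with hLr
  set u : ℝ := Real.log Lr with hu
  set A : ℝ := Real.sqrt (Δ : ℝ) / 4 with hA
  set s : ℝ := Lr / u with hs
  set x : ℝ := A * s ^ 2 with hx
  set E : ℝ := Real.exp (Lr / (8 * u)) with hE
  set l : ℕ := ⌈E⌉₊ with hl
  set FS : ℝ := formSum (NumberField.discr K) with hFS
  set T : ℝ := ∑ I ∈ S, (1 : ℝ) / (Ideal.absNorm I : ℝ) with hT
  -- parameters
  obtain ⟨hs4, hl16, hlE, hlE', hxZ', -, hxMs', -, hxl4, h2s⟩ :=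
    parameters hu100 hLu hLexp hs hE hl hA1 hMA hAM
  have hxZ : (M : ℝ) + 1 ≤ x := hxZ'
  have hxMs : x ≤ ((M : ℝ) + 1) * s ^ 2 := hxMs'
  have hA0 : 0 < A := by linarith
  have hs2s4 : s ^ 2 ≤ s ^ 4 := pow_le_pow_right₀ (by linarith) (by norm_num)
  have hxl : x ≤ l * ((M : ℝ) + 1) :=
    le_trans (mul_le_mul_of_nonneg_left hs2s4 hA0.le) hxl4
  have hM1r : (0 : ℝ) < (M : ℝ) + 1 := by positivity
  have hM0 : 0 < M :=
    hM ▸ Nat.sqrt_pos.mpr (Nat.div_pos (Nat.le_sub_of_add_le hΔ17) (by norm_num))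
  -- the three error terms
  obtain ⟨hWpos, hW⟩ := window_bound hu100 hLu hLexp (w := 2 * x / ((M : ℝ) + 1))
    (div_pos (by linarith) hM1r)
    (by
      rw [div_le_iff₀ hM1r]; show 2 * x ≤ 2 * s ^ 4 * ((M : ℝ) + 1)
      have := mul_le_mul_of_nonneg_left hs2s4 hM1r.le
      linarith [hxMs, this]) hlE
  have hR := remainder_bound (K₀ := K₀) hu100 hLu hLexp hM1r
    (hlogA ▸ Real.log_le_log hA0 hAM) hlE hlE'
  have hU := (inv_sqrt_bound hA0 hMA hM0 hx (by linarith)).trans h2s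
  -- nonnegativity of the error terms
  have hW0 : 0 ≤ (Real.log (2 * x / ((M : ℝ) + 1)) + 16) / Real.log ((l : ℝ) / 2) := by
    refine div_nonneg ?_ hWpos.le
    have : 0 ≤ Real.log (2 * x / ((M : ℝ) + 1)) :=
      Real.log_nonneg (by rw [le_div_iff₀ hM1r]; linarith)
    linarith
  have hR0 : 0 ≤ ((M : ℝ) + 1) ^ (-(1 / Real.log l)) *
      Real.exp (2 * (Real.log (Real.log l) + K₀)) :=
    mul_nonneg (Real.rpow_nonneg hM1r.le _) (Real.exp_pos _).le
  have hU0 : 0 ≤ 1 / (Nat.sqrt (⌊x⌋₊ / M) : ℝ) := by positivity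
  have hRu : Real.exp (2 * K₀) / Lr ≤ Real.exp (2 * K₀) * (u ^ 2 / Lr) := by
    rw [div_eq_mul_one_div]
    refine mul_le_mul_of_nonneg_left (div_le_div_of_nonneg_right ?_ hLr0.le) (Real.exp_pos _).le
    nlinarith
  have hpi : 1 ≤ Real.pi ^ 2 / 6 := by
    have := Real.pi_gt_three
    rw [le_div_iff₀ (by norm_num)]; nlinarith
  -- assembly
  set W := (Real.log (2 * x / ((M : ℝ) + 1)) + 16) / Real.log ((l : ℝ) / 2) with hW'
  set R := ((M : ℝ) + 1) ^ (-(1 / Real.log l)) * Real.exp (2 * (Real.log (Real.log l) + K₀))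
    with hR'
  set V := 1 / (Nat.sqrt (⌊x⌋₊ / M) : ℝ) with hV
  set c := Real.pi ^ 2 / 6 with hc
  have hc0 : 0 ≤ c := by linarith
  have herr : 2 * W + R + V ≤ (162 + Real.exp (2 * K₀)) * (u ^ 2 / Lr) := by
    linarith [hR.trans hRu]
  obtain ⟨hFS1, hup, hlow⟩ := hcore hΔ17 hl16 hxZ hxl
  have hFS0 : 0 ≤ FS := by linarith
  have hRFS : 0 ≤ c * (FS * R - R) :=
    mul_nonneg hc0 (sub_nonneg.mpr (le_mul_of_one_le_left hR0 hFS1))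
  have hFSV : 0 ≤ c * (FS * V) := mul_nonneg hc0 (mul_nonneg hFS0 hU0)
  have hFSW : 0 ≤ c * (FS * W) := mul_nonneg hc0 (mul_nonneg hFS0 hW0)
  have hFSR : 0 ≤ c * (FS * R) := mul_nonneg hc0 (mul_nonneg hFS0 hR0)
  have hcV : 0 ≤ (c - 1) * (FS * V) := mul_nonneg (by linarith) (mul_nonneg hFS0 hU0)
  have hkey : c * (FS * (2 * W + R + V)) ≤
      c * (FS * ((162 + Real.exp (2 * K₀)) * (u ^ 2 / Lr))) :=
    mul_le_mul_of_nonneg_left (mul_le_mul_of_nonneg_left herr hFS0) hc0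
  rw [abs_sub_le_iff]
  constructor
  · -- `T − cΣ' ≤ c(2WΣ' + R) ≤ cΣ'(2W + R + V)`
    linarith
  · -- `cΣ' − T ≤ Σ'V ≤ cΣ'(2W + R + V)`
    linarith

end Literature.NumberTheory.LFunctions

end
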